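import Summits.HodgeConjecture.HodgeConjecture.Theorems.F0P3LettersArchBlockCoreAdm           -- ★ D (A-p14 (g26)): `ArchBlockCore`, `ArchLevelAdmissible`, junctions; brings ★ C, B′, B, A2, p839537, p838816
import Summits.HodgeConjecture.HodgeConjecture.Theorems.F0P3HolProjectionReduction            -- ★ `compactSpace_automorphicQuotient_cm` (`hdef`, `h2` ⇒ compact quotient)
import Literature.NumberTheory.Automorphic.UnitaryGroupLevelBlockDiscreteDecomposition       -- ★-to-be E1 (A-p14 (g26)): GGPS for the archimedean factor at fixed level
import Literature.RepresentationTheory.KonnoKonno2007.JunctionCartanDecomposition          -- ★ `uFormGroup_hasCartanDecomposition`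
import Literature.NumberTheory.Automorphic.RealMatrixGroupsProofs                          -- ★ `isStarFormallyReal_complex`
import HarnessLib

/-!
# H3 ⟸ H3-core + T3 — the structure letter of ROAD «TF» from Harish-Chandra admissibility ALONE (ROAD E FILE E2; A-p14 (g26), 2026-09-01)

Cell `hodgecm-mathlib`, programme P3 «U3-mult», ROAD «TF».  ★ FILE C `h3_of_core_of_admK` needs L-adm(K∞) (`ArchLevelAdmissible`: the level-`K′` blocks of `rep c` have
admissible Harish-Chandra modules [BorelJacquet1979 §4.3]).  THIS FILE replaces that letter by **T3 = Harish-Chandra's admissibility theorem for IRREDUCIBLE unitary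
representations of `U(2,1)`** (the tree's named fact ★ `GKModules.isAdmissibleGK_of_irreducible_unitary` [HarishChandra1953 Thms. 4–6], read at the irreducible closed
`G′_∞`-blocks of `L²`), using the compactness of `U(H)(L⁺) \ U(H)(𝔸)` (`H` definite away from `ι`: `hdef`, `h2`; ★ `compactSpace_automorphicQuotient_cm`) and ★ FILE E1
(Gelfand–Graev–Piatetski-Shapiro for the archimedean factor at fixed level: the level-`K′` block is discretely decomposable with finite multiplicities):

* §1 `T3Blocks` shape: `t3Blocks_of_isAdmissibleGK_of_irreducible_unitary` — the named fact (BY NAME, as a hypothesis `∀ σ, isAdmissibleGK_of_irreducible_unitary U(2,1) σ`) implies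
  admissibility of the Harish-Chandra module of every irreducible closed `G′_∞`-block of `L²` under any descent (★ `isStarFormallyReal_complex`, ★ `uFormGroup_hasCartanDecomposition`).
* §2 **`exists_fin_orthogonal_blocks_of_isDiscretelyDecomposable_of_descend`** — ★ p838816's conclusion (finitely many pairwise orthogonal irreducible blocks with descents that are unitary
  globalizations of `x`, exhausting `B`) for a closed `G′_∞`-block `B` of FIXED LEVEL on the COMPACT quotient, from class isotopy of its irreducible sub-blocks ALONE (no
  `K`-admissibility): discrete decomposability + finite multiplicity (★ E1) + Harish-Chandra Thm 8 (★ `areUnitarilyEquivalent_restrict_of_descend`) + ★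
  `le_multiplicity_of_pairwise_isOrtho` + ★ `iSup_eq_top_of_dense_of_orthogonal`.
* §3 **`h3_of_core_of_t3`** : `hdef → h2 → ‹T3 at blocks› → ‹H3-core› → ‹H3 verbatim›` (★ FILE C's proof with §2 for ★ p838816 and ★ B′ `liso_of_isAdmissibleGK` fed by T3);
  **`archBlockStructure_of_core_of_t3`**, **`archLevelAdmissible`-free junction `archFinTraceSplit_of_core_of_t3`**.

BOOKS (the desk's ∕ director's count): the (H) block reads **H3 ⟸ {H3-core, T3}** with T3 = `GKModules.isAdmissibleGK_of_irreducible_unitary` at `U(2,1)` [HarishChandra1953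
Thms. 4–6] — the GENERIC Lie-theoretic named fact, no automorphic admissibility letter; L-iso, F1a, L-adm are NOT letters of this block.  THEOREMS ONLY; no definition, no instance,
no notation, no named fact, no `sorry`.  NON-CLAIMS: `hdef`∕`h2` (compact quotient) are used; T3 itself is not proved.  HONEST LABEL: HC_CM is proved only modulo the 2 remaining
named inputs (hLiu418, h413) until rung 0 closes; this file discharges no printed row by itself.

## References
* Harish-Chandra, *Representations of a semisimple Lie group on a Banach space I*, Trans. AMS 75 (1953), §9 Thms. 4–6 (p. 224), §11 Thm. 8 (p. 231) [HarishChandraTAMS1953].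
* D. Flath, *Decomposition of representations into tensor products*, Corvallis 1979, part 1, Thm. 4 [FlathCorvallis1979].
* A. Borel, H. Jacquet, *Automorphic forms and automorphic representations*, Corvallis 1979, part 1, §4.3 and §4.6 [BorelJacquet1979].
* A. Deitmar, S. Echterhoff, *Principles of Harmonic Analysis*, 2nd ed. (2014), Thm. 9.2.2, Lemma 9.2.7 [DeitmarEchterhoff2014].
* J. Dixmier, *C\*-algebras* (1977), §13.1.2, §13.1.5, §13.1.8 [Dixmier1977].
-/

-- Mathlib idiom (as in ★ `GKModules`): commutator bracket, needed to MENTION `GKIrrClass (uFormGroup …)` ∕ `IsUnitaryGlobalization` ∕ `harishChandraRepK`.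
attribute [local instance 100] LieRing.ofAssociativeRing

set_option autoImplicit false
-- the mandated namespace repeats `HodgeConjecture.HodgeConjecture`, as in every `Theorems/*.lean` of this sub-problem
set_option linter.dupNamespace false

noncomputable section

open MeasureTheory Measure NumberField CompactlySupported Topology
open Literature.NumberTheory.Automorphic Literature.NumberTheory.Automorphic.UnitaryGroup
open Literature.NumberTheory.Automorphic.UnitaryGroup.CotangentForms
open Literature.RepresentationTheory Literature.RepresentationTheory.KonnoKonno2007 Literature.RepresentationTheory.KonnoKonno2007.RealDualPair
open Literature.RepresentationTheory.BorelWallach2000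
open scoped Matrix InnerProductSpace ENNReal ComplexOrder

namespace Summit.HodgeConjecture.HodgeConjecture.Cruxes.H413.F0P3ArchStructureOfT3

open Summit.HodgeConjecture.HodgeConjecture.Cruxes.H413.F0P3InnerFormClassificationV6
open Summit.HodgeConjecture.HodgeConjecture.Cruxes.H413.F0P3ClassTokensOfRecord (Cls rep)
open Summit.HodgeConjecture.HodgeConjecture.Cruxes.H413.F0P3CompactTrivOfRecord (cptTriv₀)
open Summit.HodgeConjecture.HodgeConjecture.Cruxes.H413.F0P3UnitaryLocOfRecord (clInfChoiceU)
open Summit.HodgeConjecture.HodgeConjecture.Cruxes.H413.F0P3bArchDegOneClass (archDegOneClass)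
open Summit.HodgeConjecture.HodgeConjecture.Cruxes.H413.F0P3LettersTraceFactorisation (IsProductHaar)
open Summit.HodgeConjecture.HodgeConjecture.Cruxes.H413.F0P3LettersArchFinTraceSplit (ArchFinTraceSplit)
open Summit.HodgeConjecture.HodgeConjecture.Cruxes.H413.F0P3LettersArchBlockStructure (ArchBlockStructure archFinTraceSplit_of_archBlockStructure)
open Summit.HodgeConjecture.HodgeConjecture.Cruxes.H413.F0P3LettersArchBlockCoreAdm (ArchBlockCore)
open Summit.HodgeConjecture.HodgeConjecture.Cruxes.H413.F0P3ArchTraceOfRealisation (exists_descend_archProjUForm isUnitary_of_descend isStronglyContinuous_of_descend)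
open Summit.HodgeConjecture.HodgeConjecture.Cruxes.H413.F0P3ArchFixedBlockDecompositionOfAdmissible (iSup_eq_top_of_dense_of_orthogonal)
open Summit.HodgeConjecture.HodgeConjecture.Cruxes.H413.F0P3ArchIsotypicBlockOfGlobalizations (areUnitarilyEquivalent_restrict_of_descend)
open Summit.HodgeConjecture.HodgeConjecture.Cruxes.H413.F0P3ArchStructureLetterSplit (exists_descend_toContRep isUnitaryGlobalization_of_descend_of_areUnitarilyEquivalent toContRep_eq_one_of_cptTriv₀)
open Summit.HodgeConjecture.HodgeConjecture.Cruxes.H413.F0P3ArchBlockClassOfArchIsotypy (isTopIrreducible_of_descend)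
open Summit.HodgeConjecture.HodgeConjecture.Cruxes.H413.F0P3ArchIsotypyOfAdmissibleBlock (liso_of_isAdmissibleGK)
open Summit.HodgeConjecture.HodgeConjecture.Cruxes.H413.F0P3HolProjectionReduction (compactSpace_automorphicQuotient_cm)
open ContRepresentation (ClosedSubrep AreUnitarilyEquivalent)

variable (L : Type) [Field L] [NumberField L] [IsCMField L] (H : Matrix (Fin 3) (Fin 3) L) (ι : L →+* ℂ) (T : GL (Fin 3) ℂ)
  (hT : (T : Matrix (Fin 3) (Fin 3) ℂ)ᴴ * H.map ι * (T : Matrix (Fin 3) (Fin 3) ℂ) = Literature.Geometry.ComplexHyperbolic.BallModel.J)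
  (μ : Measure (Gp L H).automorphicQuotient) [(Gp L H).IsAutomorphicMeasure μ]

/-! ## §1 T3 at the blocks from the named fact -/

/-- **T3 AT THE BLOCKS OF `L²` FROM HARISH-CHANDRA'S ADMISSIBILITY THEOREM BY NAME**: if ★ `isAdmissibleGK_of_irreducible_unitary` holds for every representation of `U(2,1)`
(on Hilbert spaces in `Type`), then every irreducible closed `G′_∞`-block `W ≤ L²` descending to `σ` along `archProjUForm` has an admissible Harish-Chandra module — its
hypotheses `IsStarFormallyReal ℂ` (★ `isStarFormallyReal_complex`) and the global Cartan decomposition of `U(2,1)` (★ `uFormGroup_hasCartanDecomposition`) are ★, and `σ` is unitary,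
strongly continuous and topologically irreducible (★ p838350, ★ B `isTopIrreducible_of_descend`). [cite: HarishChandraTAMS1953, §9 Thm. 4 (p. 224)] [cite: Knapp2002, Thm. 6.31 (c)] -/
theorem t3Blocks_of_isAdmissibleGK_of_irreducible_unitary
    (hT3 : ∀ {E : Type} [NormedAddCommGroup E] [InnerProductSpace ℂ E] [CompleteSpace E]
      (σ : ContRepresentation ℂ (uFormGroup (Fin 2) (Fin 1)).carrier E), isAdmissibleGK_of_irreducible_unitary (uFormGroup (Fin 2) (Fin 1)) σ)
    (W : ClosedSubrep (((Gp L H).rightRegular μ).restrict (archToAdelic (↥(maximalRealSubfield L)) L (IsCMField.complexConj L) 3 H)))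
    (σ : ContRepresentation ℂ (uFormGroup (Fin 2) (Fin 1)).carrier W.toSubmodule) (hirr : W.toContRep.IsTopIrreducible)
    (hσ : ∀ g, W.toContRep g = σ (archProjUForm L ι H T hT g)) :
    IsAdmissibleGK (harishChandraRepK (uFormGroup (Fin 2) (Fin 1)) σ) := by
  have hRu : ((Gp L H).rightRegular μ).IsUnitary := (Gp L H).isUnitary_rightRegular μ
  have hRc : ((Gp L H).rightRegular μ).IsStronglyContinuous := (Gp L H).isStronglyContinuous_rightRegular_holds μ
  have hπu : (((Gp L H).rightRegular μ).restrict (archToAdelic (↥(maximalRealSubfield L)) L (IsCMField.complexConj L) 3 H)).IsUnitary := hRu.restrict _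
  have hπc : (((Gp L H).rightRegular μ).restrict (archToAdelic (↥(maximalRealSubfield L)) L (IsCMField.complexConj L) 3 H)).IsStronglyContinuous :=
    hRc.restrict _ (continuous_archToAdelic (↥(maximalRealSubfield L)) L (IsCMField.complexConj L) 3 H)
  have hWu : W.toContRep.IsUnitary := hπu.toContRep W
  have hWc : W.toContRep.IsStronglyContinuous := fun v => by
    have h1 : Continuous fun g => ((W.toContRep g v : W.toSubmodule) : (Gp L H).L2 μ) := by
      simp only [ClosedSubrep.coe_toContRep_apply]
      exact hπc (v : (Gp L H).L2 μ)
    exact continuous_induced_rng.2 h1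
  exact hT3 σ isStarFormallyReal_complex (uFormGroup_hasCartanDecomposition (Fin 2) (Fin 1)) (isUnitary_of_descend L ι H T hT hσ hWu)
    (isStronglyContinuous_of_descend L ι H T hT hσ hWc) (isTopIrreducible_of_descend L ι H T hT hσ hirr)

/-! ## §2 Finite orthogonal block decomposition of a fixed-level block on the compact quotient, from class isotopy alone -/

/-- **★ p838816's CONCLUSION WITHOUT `K`-ADMISSIBILITY** (generic `π` of `G′_∞` on a Hilbert space): if `π` is unitary, DISCRETELY DECOMPOSABLE with FINITE MULTIPLICITIES (★ E1 for a
fixed-level block on the compact quotient) and its irreducible closed sub-blocks all descend to unitary globalizations of ONE class `x`, then `π` is the sum of FINITELY MANY pairwise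
orthogonal such sub-blocks: take an orthogonal decomposition `S`; Harish-Chandra Thm 8 (★ `areUnitarilyEquivalent_restrict_of_descend`) makes the members of `S` pairwise equivalent, so `|S| ≤ mult < ∞`
(★ `le_multiplicity_of_pairwise_isOrtho`); a finite orthogonal dense sum is everything (★ `iSup_eq_top_of_dense_of_orthogonal`). [cite: DeitmarEchterhoff2014, Thm. 9.2.2]
[cite: HarishChandraTAMS1953, §11 Thm. 8 (p. 231)] [cite: Dixmier1977, §13.1.5] -/
theorem exists_fin_orthogonal_blocks_of_isDiscretelyDecomposable_of_descend
    {x : GKIrrClass (uFormGroup (Fin 2) (Fin 1))}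
    {E : Type} [NormedAddCommGroup E] [InnerProductSpace ℂ E] [CompleteSpace E]
    {π : ContRepresentation ℂ (arch (↥(maximalRealSubfield L)) L (IsCMField.complexConj L) 3 H) E} (hu : π.IsUnitary)
    (hd : π.IsDiscretelyDecomposable) (hmult : ∀ W₀ : ClosedSubrep π, W₀ ≠ ⊥ → π.multiplicity W₀.toContRep < ⊤)
    (hiso : ∀ W : ClosedSubrep π, W.toContRep.IsTopIrreducible →
      ∃ σbar : ContRepresentation ℂ (uFormGroup (Fin 2) (Fin 1)).carrier W.toSubmodule,
        (∀ g, W.toContRep g = σbar (archProjUForm L ι H T hT g)) ∧ IsUnitaryGlobalization (uFormGroup (Fin 2) (Fin 1)) x σbar) :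
    ∃ (n : ℕ) (W : Fin n → ClosedSubrep π) (σbar : ∀ i, ContRepresentation ℂ (uFormGroup (Fin 2) (Fin 1)).carrier (W i).toSubmodule),
      (∀ i j, i ≠ j → (W i).toSubmodule ⟂ (W j).toSubmodule) ∧ (∀ i, (W i).toContRep.IsTopIrreducible) ∧
      (∀ i g, (W i).toContRep g = σbar i (archProjUForm L ι H T hT g)) ∧
      (∀ i, IsUnitaryGlobalization (uFormGroup (Fin 2) (Fin 1)) x (σbar i)) ∧ (⨆ i, (W i).toSubmodule) = ⊤ := by
  classical
  obtain ⟨S, hSirr, hSorth, hStop⟩ := hu.exists_orthogonalDecomposition_of_isDiscretelyDecomposable hd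
  -- descents of the members of `S`
  choose σb hσb hxb using fun W (hW : W ∈ S) => hiso W (hSirr W hW)
  -- all members of `S` are unitarily equivalent (Harish-Chandra Thm 8 at `U(2,1)`)
  have hequiv : ∀ W₀ ∈ S, ∀ W ∈ S, AreUnitarilyEquivalent W₀.toContRep W.toContRep := by
    intro W₀ hW₀ W hW
    have h1 : AreUnitarilyEquivalent ((σb W₀ hW₀).restrict (archProjUForm L ι H T hT)) W.toContRep :=
      areUnitarilyEquivalent_restrict_of_descend L ι H T hT (hxb W₀ hW₀) W.toContRep (hσb W hW) (hxb W hW)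
    have h0 : AreUnitarilyEquivalent ((σb W₀ hW₀).restrict (archProjUForm L ι H T hT)) W₀.toContRep :=
      areUnitarilyEquivalent_restrict_of_descend L ι H T hT (hxb W₀ hW₀) W₀.toContRep (hσb W₀ hW₀) (hxb W₀ hW₀)
    exact h0.symm.trans h1
  -- `S` is finite: its members are pairwise orthogonal copies of ONE irreducible of finite multiplicity
  have hSfin : S.Finite := by
    by_cases hS : S = ∅
    · rw [hS]; exact Set.finite_empty
    obtain ⟨W₀, hW₀⟩ := Set.nonempty_iff_ne_empty.mpr hS
    have hm := hmult W₀ (ClosedSubrep.ne_bot_of_isTopIrreducible (hSirr W₀ hW₀))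
    obtain ⟨m, hm'⟩ := ENat.ne_top_iff_exists.mp hm.ne
    by_contra hinf
    obtain ⟨t, htS, htcard⟩ := Set.Infinite.exists_subset_card_eq hinf (m + 1)
    have hle := ContRepresentation.le_multiplicity_of_pairwise_isOrtho (π := π) (W := fun W : t => (W : ClosedSubrep π))
      (fun W => hSirr _ (htS W.2)) (fun i j hij => hSorth (htS i.2) (htS j.2) (fun h => hij (Subtype.ext h))) (σ := W₀.toContRep)
      Finset.univ (fun i _ => (hequiv W₀ hW₀ _ (htS i.2)).symm)
    rw [Finset.card_univ, Fintype.card_coe, htcard, ← hm'] at hle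
    have : (m + 1 : ℕ) ≤ m := by exact_mod_cast hle
    omega
  -- index by `Fin n`
  haveI : Finite S := hSfin.to_subtype
  obtain ⟨n, ⟨eqv⟩⟩ := Finite.exists_equiv_fin S
  let W : Fin n → ClosedSubrep π := fun i => (eqv.symm i).1
  have hWmem : ∀ i, W i ∈ S := fun i => (eqv.symm i).2
  have hWinj : Function.Injective W := fun i j h => eqv.symm.injective (Subtype.ext h)
  refine ⟨n, W, fun i => σb (W i) (hWmem i), fun i j hij => hSorth (hWmem i) (hWmem j) (fun h => hij (hWinj h)),
    fun i => hSirr _ (hWmem i), fun i g => hσb _ (hWmem i) g, fun i => hxb _ (hWmem i), ?_⟩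
  have hsup : (⨆ i, (W i).toSubmodule) = ⨆ W' ∈ S, (W' : ClosedSubrep π).toSubmodule := by
    apply le_antisymm
    · exact iSup_le fun i => le_iSup₂_of_le (W i) (hWmem i) le_rfl
    · refine iSup₂_le fun W' hW' => ?_
      have : W' = W (eqv ⟨W', hW'⟩) := by
        change W' = (eqv.symm (eqv ⟨W', hW'⟩)).1
        rw [Equiv.symm_apply_apply]
      rw [this]
      exact le_iSup (fun i => (W i).toSubmodule) _
  have hdense : (⨆ i, (W i).toSubmodule).topologicalClosure = ⊤ := by
    rw [hsup, Submodule.topologicalClosure_eq_top_iff]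
    exact (ClosedSubrep.iSupClosure_eq_top_iff S).mp hStop
  exact iSup_eq_top_of_dense_of_orthogonal (fun i => (W i).toSubmodule) (fun i j hij => hSorth (hWmem i) (hWmem j) (fun h => hij (hWinj h))) hdense

/-! ## §3 H3 from H3-core and T3 -/

variable [MeasurableSpace (Gp L H).Adelic] (ν : Measure (Gp L H).Adelic)
  (νinf : @Measure (UnitaryGroup.arch (↥(maximalRealSubfield L)) L (IsCMField.complexConj L) 3 H) (borel _))
  (μv : ∀ v : Places L, @Measure ((cmDatum L 3 H).Local v) (borel _))

-- one long statement (the letter H3 twice) and the instance-path unifications `ClosedSubrep B.toContRep` ↔ §2's spelling (as in ★ p839537 ∕ ★ C: 3.2M measured there)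
set_option maxHeartbeats 3200000 in
/-- **H3 ⟸ H3-core + T3** (`hdef`, `h2`: compact quotient).  Hypotheses: `hT3` = Harish-Chandra admissibility at the irreducible closed `G′_∞`-blocks of `L²` (the shape produced by
`t3Blocks_of_isAdmissibleGK_of_irreducible_unitary` from the named fact), `hcore` = H3-core (★ p839537's binder verbatim).  Conclusion: the structure letter H3 VERBATIM.  PROOF = ★ FILE C's
with ★ p838816 replaced by §2 (the level-`K′` block has `K′`-fixed vectors; compact quotient) and the class of each irreducible sub-block from ★ B′ `liso_of_isAdmissibleGK` fed by `hT3`.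
[cite: FlathCorvallis1979, Thm. 4] [cite: BorelJacquet1979, §4.6] [cite: HarishChandraTAMS1953, §9 Thm. 4 (p. 224), §11 Thm. 8 (p. 231)] [cite: Dixmier1977, §13.1.2, §13.1.8] -/
theorem h3_of_core_of_t3
    (hdef : ∀ τ' : L →+* ℂ, InfinitePlace.mk τ' ≠ InfinitePlace.mk ι → (H.map τ').PosDef) (h2 : 2 ≤ Module.finrank ℚ ↥(maximalRealSubfield L))
    (hT3 : ∀ (W : ClosedSubrep (((Gp L H).rightRegular μ).restrict (archToAdelic (↥(maximalRealSubfield L)) L (IsCMField.complexConj L) 3 H)))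
      (σ : ContRepresentation ℂ (uFormGroup (Fin 2) (Fin 1)).carrier W.toSubmodule), W.toContRep.IsTopIrreducible →
      (∀ g, W.toContRep g = σ (archProjUForm L ι H T hT g)) → IsAdmissibleGK (harishChandraRepK (uFormGroup (Fin 2) (Fin 1)) σ))
    (hcore :
      letI : MeasurableSpace (UnitaryGroup.arch (↥(maximalRealSubfield L)) L (IsCMField.complexConj L) 3 H) := borel _
      letI : MeasurableSpace (finAdelic (↥(maximalRealSubfield L)) L (IsCMField.complexConj L) 3 H) := borel _
      haveI : BorelSpace (finAdelic (↥(maximalRealSubfield L)) L (IsCMField.complexConj L) 3 H) := ⟨rfl⟩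
      IsProductHaar L H ν νinf μv →
        ∀ (νf : Measure (finAdelic (↥(maximalRealSubfield L)) L (IsCMField.complexConj L) 3 H)),
          ν = Measure.map (adelicProdEquiv (↥(maximalRealSubfield L)) L (IsCMField.complexConj L) 3 H).symm.toMulEquiv (νinf.prod νf) →
          ∀ c : Cls (Gp L H) μ, cptTriv₀ L ι H T hT μ c →
            ∃ (W : Type) (_ : AddCommGroup W) (_ : Module ℂ W) (σ : Representation ℂ (finAdelic (↥(maximalRealSubfield L)) L (IsCMField.complexConj L) 3 H) W),
              σ.IsIrreducible ∧ σ.IsAdmissible ∧ σ.IsSmooth ∧ (rep (Gp L H) μ c).HasFinComponent σ ∧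
              ∀ (K' : Subgroup (finAdelic (↥(maximalRealSubfield L)) L (IsCMField.complexConj L) 3 H)),
                IsOpen (K' : Set (finAdelic (↥(maximalRealSubfield L)) L (IsCMField.complexConj L) 3 H)) →
                IsCompact (K' : Set (finAdelic (↥(maximalRealSubfield L)) L (IsCMField.complexConj L) 3 H)) →
                ∀ (n : ℕ)
                  (W : Fin n → ClosedSubrep (((Gp L H).rightRegular μ).restrict (archToAdelic (↥(maximalRealSubfield L)) L (IsCMField.complexConj L) 3 H)))
                  (σbar : ∀ i, ContRepresentation ℂ (uFormGroup (Fin 2) (Fin 1)).carrier (W i).toSubmodule),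
                  (∀ i j, i ≠ j → (W i).toSubmodule ⟂ (W j).toSubmodule) →
                  (∀ i, (W i).toSubmodule ≤ (rep (Gp L H) μ c).space.toSubmodule) →
                  (∀ i g, (W i).toContRep g = σbar i (archProjUForm L ι H T hT g)) →
                  (∀ i, IsUnitaryGlobalization (uFormGroup (Fin 2) (Fin 1))
                    (clInfChoiceU L H ι T hT μ (archDegOneClass 1 (Or.inl rfl)) (rep (Gp L H) μ c)) (σbar i)) →
                  (∀ w : (Gp L H).L2 μ, w ∈ (rep (Gp L H) μ c).space.toSubmodule →
                    (∀ k ∈ K', (Gp L H).rightRegular μ (finAdelicToAdelic (↥(maximalRealSubfield L)) L (IsCMField.complexConj L) 3 H k) w = w) →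
                    w ∈ ⨆ i, (W i).toSubmodule) →
                  ∀ (Λ : C_c(finAdelic (↥(maximalRealSubfield L)) L (IsCMField.complexConj L) 3 H, ℂ)),
                    (∀ k ∈ K', ∀ b, Λ (b * k) = Λ b) → (∀ k ∈ K', ∀ b, Λ (k * b) = Λ b) →
                    ∀ (u : Fin n → (Gp L H).L2 μ), (∀ i, u i ∈ (W i).toSubmodule ∧ ‖u i‖ = 1) →
                    ∀ [IsFiniteMeasureOnCompacts νf],
                      ∑ i, ⟪u i, (((Gp L H).rightRegular μ).restrict (finAdelicToAdelic (↥(maximalRealSubfield L)) L (IsCMField.complexConj L) 3 H)).integratedOperator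
                          (((Gp L H).isUnitary_rightRegular μ).restrict _)
                          (((Gp L H).isStronglyContinuous_rightRegular_holds μ).restrict _
                            (continuous_finAdelicToAdelic (↥(maximalRealSubfield L)) L (IsCMField.complexConj L) 3 H)) νf Λ (u i)⟫_ℂ =
                        σ.smoothTrace νf ⇑Λ) :
    letI : MeasurableSpace (UnitaryGroup.arch (↥(maximalRealSubfield L)) L (IsCMField.complexConj L) 3 H) := borel _
    letI : MeasurableSpace (finAdelic (↥(maximalRealSubfield L)) L (IsCMField.complexConj L) 3 H) := borel _
    haveI : BorelSpace (finAdelic (↥(maximalRealSubfield L)) L (IsCMField.complexConj L) 3 H) := ⟨rfl⟩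
    IsProductHaar L H ν νinf μv →
      ∀ (νf : Measure (finAdelic (↥(maximalRealSubfield L)) L (IsCMField.complexConj L) 3 H)),
        ν = Measure.map (adelicProdEquiv (↥(maximalRealSubfield L)) L (IsCMField.complexConj L) 3 H).symm.toMulEquiv (νinf.prod νf) →
        ∀ c : Cls (Gp L H) μ, cptTriv₀ L ι H T hT μ c →
          ∃ (W : Type) (_ : AddCommGroup W) (_ : Module ℂ W) (σ : Representation ℂ (finAdelic (↥(maximalRealSubfield L)) L (IsCMField.complexConj L) 3 H) W),
            σ.IsIrreducible ∧ σ.IsAdmissible ∧ σ.IsSmooth ∧ (rep (Gp L H) μ c).HasFinComponent σ ∧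
            ∀ (K' : Subgroup (finAdelic (↥(maximalRealSubfield L)) L (IsCMField.complexConj L) 3 H)),
              IsOpen (K' : Set (finAdelic (↥(maximalRealSubfield L)) L (IsCMField.complexConj L) 3 H)) →
              IsCompact (K' : Set (finAdelic (↥(maximalRealSubfield L)) L (IsCMField.complexConj L) 3 H)) →
              ∃ (n : ℕ)
                (W : Fin n → ClosedSubrep (((Gp L H).rightRegular μ).restrict (archToAdelic (↥(maximalRealSubfield L)) L (IsCMField.complexConj L) 3 H)))
                (σbar : ∀ i, ContRepresentation ℂ (uFormGroup (Fin 2) (Fin 1)).carrier (W i).toSubmodule),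
                (∀ i j, i ≠ j → (W i).toSubmodule ⟂ (W j).toSubmodule) ∧
                (∀ i, (W i).toSubmodule ≤ (rep (Gp L H) μ c).space.toSubmodule) ∧
                (∀ i g, (W i).toContRep g = σbar i (archProjUForm L ι H T hT g)) ∧
                (∀ i, IsUnitaryGlobalization (uFormGroup (Fin 2) (Fin 1))
                  (clInfChoiceU L H ι T hT μ (archDegOneClass 1 (Or.inl rfl)) (rep (Gp L H) μ c)) (σbar i)) ∧
                (∀ w : (Gp L H).L2 μ, w ∈ (rep (Gp L H) μ c).space.toSubmodule →
                  (∀ k ∈ K', (Gp L H).rightRegular μ (finAdelicToAdelic (↥(maximalRealSubfield L)) L (IsCMField.complexConj L) 3 H k) w = w) →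
                  w ∈ ⨆ i, (W i).toSubmodule) ∧
                (∀ (Λ : C_c(finAdelic (↥(maximalRealSubfield L)) L (IsCMField.complexConj L) 3 H, ℂ)),
                  (∀ k ∈ K', ∀ b, Λ (b * k) = Λ b) → (∀ k ∈ K', ∀ b, Λ (k * b) = Λ b) →
                  ∀ (u : Fin n → (Gp L H).L2 μ), (∀ i, u i ∈ (W i).toSubmodule ∧ ‖u i‖ = 1) →
                  ∀ [IsFiniteMeasureOnCompacts νf],
                    ∑ i, ⟪u i, (((Gp L H).rightRegular μ).restrict (finAdelicToAdelic (↥(maximalRealSubfield L)) L (IsCMField.complexConj L) 3 H)).integratedOperator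
                        (((Gp L H).isUnitary_rightRegular μ).restrict _)
                        (((Gp L H).isStronglyContinuous_rightRegular_holds μ).restrict _
                          (continuous_finAdelicToAdelic (↥(maximalRealSubfield L)) L (IsCMField.complexConj L) 3 H)) νf Λ (u i)⟫_ℂ =
                      σ.smoothTrace νf ⇑Λ) := by
  haveI : CompactSpace (Gp L H).automorphicQuotient := compactSpace_automorphicQuotient_cm (L := L) (ι := ι) (H := H) hdef h2
  intro hPH νf hν c hc
  obtain ⟨Wσ, i1, i2, σ, hirr, hadmσ, hsm, hfin, hK⟩ := hcore hPH νf hν c hc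
  refine ⟨Wσ, i1, i2, σ, hirr, hadmσ, hsm, hfin, fun K' hKo hKc => ?_⟩
  -- the ambient representation of `G′_∞` on `L²`
  have hRu : ((Gp L H).rightRegular μ).IsUnitary := (Gp L H).isUnitary_rightRegular μ
  have hRc : ((Gp L H).rightRegular μ).IsStronglyContinuous := (Gp L H).isStronglyContinuous_rightRegular_holds μ
  have hπu : (((Gp L H).rightRegular μ).restrict (archToAdelic (↥(maximalRealSubfield L)) L (IsCMField.complexConj L) 3 H)).IsUnitary :=
    hRu.restrict _
  have hπc : (((Gp L H).rightRegular μ).restrict (archToAdelic (↥(maximalRealSubfield L)) L (IsCMField.complexConj L) 3 H)).IsStronglyContinuous :=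
    hRc.restrict _ (continuous_archToAdelic (↥(maximalRealSubfield L)) L (IsCMField.complexConj L) 3 H)
  -- the level-`K'` block `B` of `rep c` (an opaque witness with its membership characterisation), exactly as in ★ p839537 ∕ ★ C
  obtain ⟨B, hBchar⟩ : ∃ B : ClosedSubrep (((Gp L H).rightRegular μ).restrict (archToAdelic (↥(maximalRealSubfield L)) L (IsCMField.complexConj L) 3 H)),
      ∀ w : (Gp L H).L2 μ, w ∈ B.toSubmodule ↔
        (w ∈ (rep (Gp L H) μ c).space.toSubmodule ∧
          ∀ k ∈ K', (Gp L H).rightRegular μ (finAdelicToAdelic (↥(maximalRealSubfield L)) L (IsCMField.complexConj L) 3 H k) w = w) :=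
   ⟨{ toSubmodule :=
        { carrier := {w | w ∈ (rep (Gp L H) μ c).space.toSubmodule ∧
            ∀ k ∈ K', (Gp L H).rightRegular μ (finAdelicToAdelic (↥(maximalRealSubfield L)) L (IsCMField.complexConj L) 3 H k) w = w}
          add_mem' := fun {a b} ha hb => ⟨Submodule.add_mem _ ha.1 hb.1, fun k hk => by rw [map_add, ha.2 k hk, hb.2 k hk]⟩
          zero_mem' := ⟨Submodule.zero_mem _, fun k _ => map_zero _⟩
          smul_mem' := fun a {w} hw => ⟨Submodule.smul_mem _ a hw.1, fun k hk => by rw [map_smul, hw.2 k hk]⟩ }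
      apply_mem_toSubmodule := fun g {w} hw => by
        refine ⟨(rep (Gp L H) μ c).space.apply_mem (archToAdelic (↥(maximalRealSubfield L)) L (IsCMField.complexConj L) 3 H g) hw.1,
          fun k hk => ?_⟩
        change (Gp L H).rightRegular μ (finAdelicToAdelic _ L _ 3 H k)
            ((Gp L H).rightRegular μ (archToAdelic _ L _ 3 H g) w) = (Gp L H).rightRegular μ (archToAdelic _ L _ 3 H g) w
        have hmul : ∀ (a b : (Gp L H).Adelic) (w' : (Gp L H).L2 μ),
            (Gp L H).rightRegular μ (a * b) w' = (Gp L H).rightRegular μ a ((Gp L H).rightRegular μ b w') := fun a b w' => by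
          rw [map_mul]; rfl
        rw [← hmul, ← (commute_archToAdelic_finAdelicToAdelic (↥(maximalRealSubfield L)) L (IsCMField.complexConj L) 3 H g k).eq, hmul,
          hw.2 k hk]
      isClosed' := by
        change IsClosed {w : (Gp L H).L2 μ | w ∈ (rep (Gp L H) μ c).space.toSubmodule ∧
            ∀ k ∈ K', (Gp L H).rightRegular μ (finAdelicToAdelic (↥(maximalRealSubfield L)) L (IsCMField.complexConj L) 3 H k) w = w}
        have h1 : IsClosed {w : (Gp L H).L2 μ |
            ∀ k ∈ K', (Gp L H).rightRegular μ (finAdelicToAdelic (↥(maximalRealSubfield L)) L (IsCMField.complexConj L) 3 H k) w = w} := by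
          rw [Set.setOf_forall]
          refine isClosed_iInter fun k => ?_
          by_cases hk : k ∈ K'
          · have h3 : {w : (Gp L H).L2 μ | k ∈ K' →
                  (Gp L H).rightRegular μ (finAdelicToAdelic (↥(maximalRealSubfield L)) L (IsCMField.complexConj L) 3 H k) w = w} =
                {w | (Gp L H).rightRegular μ (finAdelicToAdelic (↥(maximalRealSubfield L)) L (IsCMField.complexConj L) 3 H k) w = w} := by
              ext w; simp only [Set.mem_setOf_eq, hk, forall_true_left]
            rw [h3]
            exact isClosed_eq ((Gp L H).rightRegular μ _).continuous continuous_id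
          · have h3 : {w : (Gp L H).L2 μ | k ∈ K' →
                  (Gp L H).rightRegular μ (finAdelicToAdelic (↥(maximalRealSubfield L)) L (IsCMField.complexConj L) 3 H k) w = w} = Set.univ := by
              ext w; simp only [Set.mem_setOf_eq, hk, IsEmpty.forall_iff, Set.mem_univ]
            rw [h3]
            exact isClosed_univ
        have h2' : IsClosed {w : (Gp L H).L2 μ | w ∈ (rep (Gp L H) μ c).space.toSubmodule} := (rep (Gp L H) μ c).space.isClosed
        rw [Set.setOf_and]
        exact h2'.inter h1 }, fun w => Iff.rfl⟩
  have hBle : B.toSubmodule ≤ (rep (Gp L H) μ c).space.toSubmodule := fun w hw => ((hBchar w).1 hw).1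
  have hBfix : ∀ w ∈ B, ∀ k ∈ K', (Gp L H).rightRegular μ (finAdelicToAdelic (↥(maximalRealSubfield L)) L (IsCMField.complexConj L) 3 H k) w = w :=
    fun w hw k hk => ((hBchar w).1 hw).2 k hk
  have hBu : B.toContRep.IsUnitary := hπu.toContRep B
  have hBc : B.toContRep.IsStronglyContinuous := fun v => by
    have h1 : Continuous fun g => ((B.toContRep g v : B.toSubmodule) : (Gp L H).L2 μ) := by
      simp only [ClosedSubrep.coe_toContRep_apply]
      exact hπc (v : (Gp L H).L2 μ)
    exact continuous_induced_rng.2 h1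
  -- inflated blocks lie in `rep c`
  have hinfl_le : ∀ Wb : ClosedSubrep B.toContRep, (B.inflate Wb).toSubmodule ≤ (rep (Gp L H) μ c).space.toSubmodule :=
    fun Wb v hv => hBle ((B.inflate_le Wb) hv)
  have hkerB : ∀ g, archProjUForm L ι H T hT g = 1 → B.toContRep g = 1 := toContRep_eq_one_of_cptTriv₀ L H ι T hT μ c hc B hBle
  -- §2 on `B`: the class of every irreducible sub-block from ★ B′ fed by T3 on the INFLATED block, transported to `Wb`'s own descent
  have hdB := isDiscretelyDecomposable_toContRep_of_fixed (↥(maximalRealSubfield L)) L (IsCMField.complexConj L) 3 H K' hKo hKc B hBfix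
  have hmultB := multiplicity_lt_top_toContRep_of_fixed (↥(maximalRealSubfield L)) L (IsCMField.complexConj L) 3 H K' hKo hKc B hBfix
  obtain ⟨n, Wb, -, horthb, hirrb, -, -, htop⟩ :=
    exists_fin_orthogonal_blocks_of_isDiscretelyDecomposable_of_descend L H ι T hT
      (x := clInfChoiceU L H ι T hT μ (archDegOneClass 1 (Or.inl rfl)) (rep (Gp L H) μ c)) hBu hdB hmultB
      (fun Wb hWb => by
        let Wr : ClosedSubrep B.toContRep := Wb
        have hirr' : (B.inflate Wr).toContRep.IsTopIrreducible := (B.isTopIrreducible_inflate_iff Wr).2 hWb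
        obtain ⟨σ', hσ'⟩ := exists_descend_archProjUForm L ι H T hT (B.inflate Wr).toContRep
          (toContRep_eq_one_of_cptTriv₀ L H ι T hT μ c hc (B.inflate Wr) (hinfl_le Wr))
        have hglob' := liso_of_isAdmissibleGK L ι H T hT (archDegOneClass 1 (Or.inl rfl)) c (B.inflate Wr) (hinfl_le Wr) hirr' σ' hσ'
          (hT3 (B.inflate Wr) σ' hirr' hσ')
        obtain ⟨σb, hσb⟩ := exists_descend_toContRep L ι H T hT hkerB Wb
        exact ⟨σb, hσb, isUnitaryGlobalization_of_descend_of_areUnitarilyEquivalent L ι H T hT hBu hBc Wb hσb hσ'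
          (B.areUnitarilyEquivalent_inflate Wr).symm hglob'⟩)
  -- the blocks, read as `ClosedSubrep B.toContRep` in the ambient spelling; inflate to `L²` and descend afresh
  let Wr : Fin n → ClosedSubrep B.toContRep := Wb
  have horthr : ∀ i j, i ≠ j → (Wr i).toSubmodule ⟂ (Wr j).toSubmodule := horthb
  have hirrr : ∀ i, (Wr i).toContRep.IsTopIrreducible := hirrb
  have htopr : (⨆ i, (Wr i).toSubmodule) = ⊤ := htop
  choose σbar hσbar using fun i => exists_descend_archProjUForm L ι H T hT (B.inflate (Wr i)).toContRep
    (toContRep_eq_one_of_cptTriv₀ L H ι T hT μ c hc (B.inflate (Wr i)) (hinfl_le (Wr i)))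
  have horth : ∀ i j, i ≠ j → (B.inflate (Wr i)).toSubmodule ⟂ (B.inflate (Wr j)).toSubmodule :=
    fun i j hij => (B.isOrtho_inflate_iff).2 (horthr i j hij)
  have hle : ∀ i, (B.inflate (Wr i)).toSubmodule ≤ (rep (Gp L H) μ c).space.toSubmodule := fun i => hinfl_le (Wr i)
  have hglob : ∀ i, IsUnitaryGlobalization (uFormGroup (Fin 2) (Fin 1))
      (clInfChoiceU L H ι T hT μ (archDegOneClass 1 (Or.inl rfl)) (rep (Gp L H) μ c)) (σbar i) := fun i =>
    liso_of_isAdmissibleGK L ι H T hT (archDegOneClass 1 (Or.inl rfl)) c (B.inflate (Wr i)) (hle i)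
      ((B.isTopIrreducible_inflate_iff (Wr i)).2 (hirrr i)) (σbar i) (hσbar i)
      (hT3 (B.inflate (Wr i)) (σbar i) ((B.isTopIrreducible_inflate_iff (Wr i)).2 (hirrr i)) (hσbar i))
  have hexh : ∀ w : (Gp L H).L2 μ, w ∈ (rep (Gp L H) μ c).space.toSubmodule →
      (∀ k ∈ K', (Gp L H).rightRegular μ (finAdelicToAdelic (↥(maximalRealSubfield L)) L (IsCMField.complexConj L) 3 H k) w = w) →
      w ∈ ⨆ i, (B.inflate (Wr i)).toSubmodule := by
    intro w hw hfix
    have hwB : w ∈ B.toSubmodule := (hBchar w).2 ⟨hw, hfix⟩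
    have h1 : (⟨w, hwB⟩ : B.toSubmodule) ∈ ⨆ i, (Wr i).toSubmodule := by rw [htopr]; exact Submodule.mem_top
    have h2' : w ∈ (⨆ i, (Wr i).toSubmodule).map B.toSubmodule.subtype := ⟨⟨w, hwB⟩, h1, rfl⟩
    rw [Submodule.map_iSup] at h2'
    simpa only [ClosedSubrep.toSubmodule_inflate] using h2'
  exact ⟨n, fun i => B.inflate (Wr i), σbar, horth, hle, hσbar, hglob, hexh,
    hK K' hKo hKc n (fun i => B.inflate (Wr i)) σbar horth hle hσbar hglob hexh⟩

/-- **`ArchBlockStructure` (★ p839162) FROM `ArchBlockCore` + T3** (`hdef`, `h2`): the (H) block of the closer with NEITHER L-iso NOR F1a NOR L-adm — only Harish-Chandra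
admissibility at the blocks. [cite: FlathCorvallis1979, Thm. 4] [cite: HarishChandraTAMS1953, §9 Thm. 4 (p. 224), §11 Thm. 8 (p. 231)] -/
theorem archBlockStructure_of_core_of_t3 [IsFiniteMeasureOnCompacts ν]
    (hdef : ∀ τ' : L →+* ℂ, InfinitePlace.mk τ' ≠ InfinitePlace.mk ι → (H.map τ').PosDef) (h2 : 2 ≤ Module.finrank ℚ ↥(maximalRealSubfield L))
    (hT3 : ∀ (W : ClosedSubrep (((Gp L H).rightRegular μ).restrict (archToAdelic (↥(maximalRealSubfield L)) L (IsCMField.complexConj L) 3 H)))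
      (σ : ContRepresentation ℂ (uFormGroup (Fin 2) (Fin 1)).carrier W.toSubmodule), W.toContRep.IsTopIrreducible →
      (∀ g, W.toContRep g = σ (archProjUForm L ι H T hT g)) → IsAdmissibleGK (harishChandraRepK (uFormGroup (Fin 2) (Fin 1)) σ))
    (hcore : ArchBlockCore L H ι T hT μ ν νinf μv) : ArchBlockStructure L H ι T hT μ ν νinf μv :=
  h3_of_core_of_t3 L H ι T hT μ ν νinf μv hdef h2 hT3 hcore

/-- **#84 `ArchFinTraceSplit` FROM `ArchBlockCore` + T3** (`hdef`, `h2`). [cite: FlathCorvallis1979, Thm. 4] [cite: BorelJacquet1979, §4.6] [cite: HarishChandraTAMS1953, §11 Thm. 8 (p. 231)] -/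
theorem archFinTraceSplit_of_core_of_t3 [BorelSpace (Gp L H).Adelic] [IsFiniteMeasureOnCompacts ν]
    (hdef : ∀ τ' : L →+* ℂ, InfinitePlace.mk τ' ≠ InfinitePlace.mk ι → (H.map τ').PosDef) (h2 : 2 ≤ Module.finrank ℚ ↥(maximalRealSubfield L))
    (hT3 : ∀ (W : ClosedSubrep (((Gp L H).rightRegular μ).restrict (archToAdelic (↥(maximalRealSubfield L)) L (IsCMField.complexConj L) 3 H)))
      (σ : ContRepresentation ℂ (uFormGroup (Fin 2) (Fin 1)).carrier W.toSubmodule), W.toContRep.IsTopIrreducible →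
      (∀ g, W.toContRep g = σ (archProjUForm L ι H T hT g)) → IsAdmissibleGK (harishChandraRepK (uFormGroup (Fin 2) (Fin 1)) σ))
    (hcore : ArchBlockCore L H ι T hT μ ν νinf μv) : ArchFinTraceSplit L H ι T hT μ ν νinf μv :=
  archFinTraceSplit_of_archBlockStructure L H ι T hT μ ν νinf μv (archBlockStructure_of_core_of_t3 L H ι T hT μ ν νinf μv hdef h2 hT3 hcore)

end Summit.HodgeConjecture.HodgeConjecture.Cruxes.H413.F0P3ArchStructureOfT3

end
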